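import Summits.ResolutionOfSingularities.ResolutionOfSingularities.Theorems.SectionAscentFibrewiseClosedPointsTraceIdeal
import Mathlib.RingTheory.Ideal.Colon
import HarnessLib

/-!
# `FibrewiseClosedPoints` — support lemmas: `a · τ(J) = J · ((a) : J)` (the trace-ideal blow-up
is the blow-up of `Bl_J` along a codimension-two ideal)

Helper lemmas for crux `stmt-ResolutionOfSingularities-15960`
(`Summit.ResolutionOfSingularities.ResolutionOfSingularities.Theses.SectionAscent.FibrewiseClosedPoints`),
continuing `SectionAscentFibrewiseClosedPointsTraceIdeal.lean` (lead c2, 2026-08-17): the algebraic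
identity behind "`Bl_{τ(J)}(Spec A) ≅ Bl_{((a):J)·𝒪}(Bl_J(Spec A))`" (Stacks 080A applied to
`a·τ(J) = J·((a):J)`, `Cruxes/FibrewiseClosedPoints/ExactCentre.md` Step 4, idea
`trace-ideal-untwist` fact (B)). For a domain `A`, an ideal `J` and `0 ≠ a ∈ J`:

* `hom_apply_mem_colon` — `φ(a) ∈ ((a) : J)` for every `φ ∈ Hom_A(J, A)`;
* `exists_hom_of_mem_colon` — conversely every `x ∈ ((a) : J)` is `φ_x(a)` for the form
  `φ_x(j) = x j / a`;
* `span_singleton_mul_span_hom_eq` — **`(a) · τ(J) = J · ((a) : J)`**, where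
  `τ(J) = Ideal.span {φ(j)}` is the trace ideal (so `((a):J) = a·J⁻¹` is the honest-ideal avatar
  of `J⁻¹`, and blowing up `τ(J)` = blowing up `J` then `((a):J)`).

## Sources
* H. Lindo, J. Algebra 482 (2017), §2 (trace ideals). [Lindo2017]
* The Stacks Project, Tag 080A (blowing up a product of ideals). [StacksProject]
-/

noncomputable section

set_option linter.dupNamespace false

namespace Summit.ResolutionOfSingularities.ResolutionOfSingularities.Theorems.SectionAscent.TraceIdeal

universe u

variable {A : Type u} [CommRing A]

/-- For `φ ∈ Hom_A(J, A)` and `a ∈ J`, the value `φ(a)` multiplies `J` into `(a)`: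
`φ(a) · s = φ(s) · a`. [cite: Lindo2017, §2] -/
theorem hom_apply_mem_colon (J : Ideal A) (φ : J →ₗ[A] A) (a : J) :
    φ a ∈ (Ideal.span {(a : A)}).colon (J : Set A) := by
  rw [Submodule.mem_colon]
  intro s hs
  rw [smul_eq_mul, hom_apply_mul_comm J φ a ⟨s, hs⟩]
  exact Ideal.mem_span_singleton'.mpr ⟨φ ⟨s, hs⟩, rfl⟩

/-- **Every element of `((a) : J)` is a value at `a` of a form on `J`** (`A` a domain, `a ≠ 0`):
for `x J ⊆ (a)` the map `φ_x : J → A`, `φ_x(j) = x j / a`, is well defined and `A`-linear, and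
`φ_x(a) = x`. [cite: Lindo2017, §2] -/
theorem exists_hom_of_mem_colon [IsDomain A] (J : Ideal A) {a : A} (haJ : a ∈ J) (ha0 : a ≠ 0)
    {x : A} (hx : x ∈ (Ideal.span {a}).colon (J : Set A)) :
    ∃ φ : J →ₗ[A] A, φ ⟨a, haJ⟩ = x ∧ ∀ j : J, φ j * a = x * j := by
  classical
  rw [Submodule.mem_colon] at hx
  have hex : ∀ j : J, ∃ c : A, c * a = x * j := fun j =>
    Ideal.mem_span_singleton'.mp (by simpa [smul_eq_mul] using hx j j.2)
  choose c hc using hex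
  have hc_unique : ∀ (j : J) (d : A), d * a = x * j → d = c j := fun j d hd =>
    mul_right_cancel₀ ha0 (hd.trans (hc j).symm)
  refine ⟨{ toFun := c, map_add' := fun j j' => ?_, map_smul' := fun r j => ?_ }, ?_,
    fun j => hc j⟩
  · symm
    apply hc_unique
    rw [add_mul, hc, hc, Submodule.coe_add, mul_add]
  · symm
    apply hc_unique
    rw [RingHom.id_apply, smul_eq_mul, mul_assoc, hc, SetLike.val_smul, smul_eq_mul]
    ring
  · change c ⟨a, haJ⟩ = x
    symm
    apply hc_unique
    rfl

/-- **`(a) · τ(J) = J · ((a) : J)`** for a domain `A`, an ideal `J` and `0 ≠ a ∈ J`, where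
`τ(J) = Σ_{φ ∈ Hom(J,A)} φ(J)` is the trace ideal: `a · φ(j) = j · φ(a)` with `φ(a) ∈ ((a):J)`,
and `j · x = a · φ_x(j)`. Since blowing up is insensitive to the invertible factor `(a)` and
blowing up a product is blowing up successively (Stacks 080A), this identity presents
`Bl_{τ(J)}(Spec A)` as the blowing up of `Bl_J(Spec A)` along `((a):J)·𝒪` — an ideal that is
invertible wherever `J` is (`ExactCentre.md` Step 4). [cite: StacksProject, Tag 080A] -/
theorem span_singleton_mul_span_hom_eq [IsDomain A] (J : Ideal A) {a : A} (haJ : a ∈ J)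
    (ha0 : a ≠ 0) :
    Ideal.span {a} * Ideal.span {r : A | ∃ (φ : J →ₗ[A] A) (j : J), φ j = r} =
      J * (Ideal.span {a}).colon (J : Set A) := by
  apply le_antisymm
  · rw [Ideal.span_mul_span', Ideal.span_le]
    rintro _ ⟨a', ha', _, ⟨φ, j, rfl⟩, rfl⟩
    rw [Set.mem_singleton_iff] at ha'
    subst ha'
    -- `a φ(j) = j φ(a) ∈ J · ((a):J)`
    have key : φ j * a' = φ ⟨a', haJ⟩ * (j : A) := hom_apply_mul_comm J φ j ⟨a', haJ⟩
    have : a' * φ j = (j : A) * φ ⟨a', haJ⟩ := by rw [mul_comm a', key, mul_comm (φ _)]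
    change a' * φ j ∈ J * _
    rw [this]
    exact Ideal.mul_mem_mul j.2 (hom_apply_mem_colon J φ ⟨a', haJ⟩)
  · rw [Ideal.mul_le]
    intro j hj x hx
    obtain ⟨φ, hφa, hφ⟩ := exists_hom_of_mem_colon J haJ ha0 hx
    have : j * x = a * φ ⟨j, hj⟩ := by rw [mul_comm j, ← hφ ⟨j, hj⟩, mul_comm]
    rw [this]
    exact Ideal.mul_mem_mul (Ideal.mem_span_singleton_self a) (Ideal.subset_span ⟨φ, ⟨j, hj⟩, rfl⟩)

/-- **`((a) : J)` is all of `A` exactly where `J A_𝔭 = (a/1)`** — the untwisting ideal is trivial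
at the primes where `a` generates `J`: if `J A_𝔭 = (a)` then `((a):J) ⊄ 𝔭`. Indeed the trace ideal
is not inside `𝔭` (tree: `CechFiniteness.exists_hom_apply_not_mem`), and `a·τ(J) = J·((a):J)`
with `J A_𝔭 = a A_𝔭` forces `((a):J) A_𝔭 = A_𝔭`. Stated contrapositively-free: there is
`x ∈ ((a):J)` with `x ∉ 𝔭`. [cite: Lindo2017, §2] -/
theorem exists_mem_colon_not_mem [IsDomain A] [IsNoetherianRing A] (J : Ideal A) {a : A}
    (𝔭 : Ideal A) [𝔭.IsPrime]
    (hmap : J.map (algebraMap A (Localization.AtPrime 𝔭)) =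
      Ideal.span {algebraMap A (Localization.AtPrime 𝔭) a}) :
    ∃ x ∈ (Ideal.span {a}).colon (J : Set A), x ∉ 𝔭 := by
  classical
  set S := Localization.AtPrime 𝔭
  -- every `j ∈ J` is `j = a · (r/s)` in `A_𝔭`; for the generators of `J` take a common `s`
  obtain ⟨T, hT⟩ := (IsNoetherian.noetherian J : J.FG)
  have hgen : ∀ j ∈ J, ∃ (r : A) (s : 𝔭.primeCompl), (s : A) * j = r * a := by
    intro j hj
    have : algebraMap A S j ∈ Ideal.span {algebraMap A S a} := hmap ▸ Ideal.mem_map_of_mem _ hj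
    obtain ⟨z, hz⟩ := Ideal.mem_span_singleton'.mp this
    obtain ⟨⟨r, s⟩, hzr⟩ := IsLocalization.surj 𝔭.primeCompl z
    refine ⟨r, s, ?_⟩
    apply IsLocalization.injective S 𝔭.primeCompl_le_nonZeroDivisors
    have h1 : algebraMap A S ((s : A) * j) = z * algebraMap A S s * algebraMap A S a := by
      rw [map_mul, ← hz]; ring
    rw [h1, hzr, map_mul]
  choose r s hrs using hgen
  let s₀ : 𝔭.primeCompl := ∏ t ∈ T.attach, s t.1 (hT ▸ Ideal.subset_span t.2)
  refine ⟨s₀, ?_, s₀.2⟩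
  rw [Submodule.mem_colon]
  intro j hj
  rw [smul_eq_mul]
  -- reduce to the generators
  rw [← hT] at hj
  refine Submodule.span_induction (p := fun j _ => (s₀ : A) * j ∈ Ideal.span {a}) ?_ ?_ ?_ ?_ hj
  · intro t ht
    have hdvd : (s t (hT ▸ Ideal.subset_span ht) : A) ∣ (s₀ : A) := by
      change (s t _ : A) ∣ ((∏ t ∈ T.attach, s t.1 (hT ▸ Ideal.subset_span t.2) : 𝔭.primeCompl) : A)
      rw [Submonoid.coe_finsetProd]
      exact Finset.dvd_prod_of_mem (fun t' : T => (s t'.1 (hT ▸ Ideal.subset_span t'.2) : A))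
        (Finset.mem_attach T ⟨t, ht⟩)
    obtain ⟨q, hq⟩ := hdvd
    rw [hq, mul_comm _ q, mul_assoc, hrs t (hT ▸ Ideal.subset_span ht), ← mul_assoc]
    exact Ideal.mul_mem_left _ _ (Ideal.mem_span_singleton_self a)
  · rw [mul_zero]; exact Ideal.zero_mem _
  · intro j j' _ _ hj hj'
    rw [mul_add]; exact Ideal.add_mem _ hj hj'
  · intro c j _ hj
    rw [smul_eq_mul, mul_left_comm]; exact Ideal.mul_mem_left _ c hj

/-- **`(a) · τ(J) = J · ((a) : J)`** — registered helper of crux `stmt-ResolutionOfSingularities-15960`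
(fact (B) of the trace-ideal untwist, universe `0`, explicit binders): for a domain `A : Type`, an
ideal `J` and `0 ≠ a ∈ J`. [cite: StacksProject, Tag 080A] -/
theorem span_singleton_mul_traceIdeal_eq (A : Type) [CommRing A] [IsDomain A] (J : Ideal A) (a : A)
    (haJ : a ∈ J) (ha0 : a ≠ 0) :
    Ideal.span {a} * Ideal.span {r : A | ∃ (φ : J →ₗ[A] A) (j : J), φ j = r} =
      J * (Ideal.span {a}).colon (J : Set A) :=
  span_singleton_mul_span_hom_eq J haJ ha0

end Summit.ResolutionOfSingularities.ResolutionOfSingularities.Theorems.SectionAscent.TraceIdeal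

end
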